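import Literature.Geometry.Riemannian.MinimizingSegmentReversal
import Literature.Geometry.Riemannian.CutLocusMinimizers
import HarnessLib

/-!
# The metric `s`-section of a pair of points: symmetry, identification with minimal geodesics, measurability

For the symmetrisation `x ↔ y` in the proof of the **segment inequality** (Cheeger–Colding 1996,
Thm. 2.11 — there `ℱ_e(x, y) = inf_γ ∫₀^{d(x,y)} e(γ)` over minimal geodesics `γ` from `x` to
`y`) one needs a kernel on `M × M` that is *jointly measurable* and *symmetric*, and that along
`y = exp_x(v)`, `v ∈ ID(x)`, evaluates `e` on the minimal segment. We use the metric
`s`-sections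
`Mid_s(x, y) = {z : d(x, z) ≤ s·d(x, y), d(z, y) ≤ (1 - s)·d(x, y)}` (`0 ≤ s ≤ 1`)
and the kernel `(x, y, s) ↦ sup_{z ∈ Mid_s(x,y)} e(z)`:

* `setOf_edist_toReal_le_comm`, `iSup_setOf_edist_toReal_le_comm` — **symmetry**
  `Mid_s(x, y) = Mid_{1-s}(y, x)` (the distance is symmetric);
* `setOf_edist_toReal_le_eq_singleton` — **identification**: for `v ∈ ID(x)` and `0 ≤ s ≤ 1`,
  `Mid_s(x, exp_x v) = {exp_x(s v)}` (a point `z` with `d(x,z) + d(z,y) = d(x,y)` lies on a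
  minimizing segment from `x` through `z` to `y` — Hopf–Rinow and the prolongation lemma
  `exists_isMinimizingUpTo_of_edist_eq_add`, Lee 2018, Prop. 10.32 (a) — which is `γ_v` by
  uniqueness of minimizers inside the injectivity domain, `false_of_two_minimizers`); hence
  `iSup_setOf_edist_toReal_le_eq`: the kernel equals `e(exp_x(s v))` there;
* `measurable_iSup_setOf_edist_toReal_le` — **measurability**: on a compact connected manifold
  and for continuous `e : M → [0, ∞]` the kernel is upper semicontinuous in `(x, y, s)` (the
  graph of `Mid` is closed and `M` is compact: Berge's argument), hence Borel measurable.

No definitions, no named facts (D-0026).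

## References

* J. Cheeger, T. H. Colding, *Lower bounds on Ricci curvature and the almost rigidity of warped
  products*, Ann. of Math. (2) 144 (1996), Thm. 2.11. [CheegerColding1996]
* J. M. Lee, *Introduction to Riemannian Manifolds*, 2nd ed. (2018), Prop. 10.32 (a), Lemma 6.18,
  Cor. 6.12. [LeeRiemannianManifolds2018]
-/

noncomputable section

open Bundle Set Function Filter MeasureTheory Manifold
open scoped Manifold ContDiff Topology ENNReal NNReal

namespace Literature.Geometry.Riemannian

open Lorentzian Lorentzian.PseudoRiemannianMetric

section General

variable {E : Type*} [NormedAddCommGroup E] [NormedSpace ℝ E] {H : Type*} [TopologicalSpace H]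
  {I : ModelWithCorners ℝ E H} {M : Type*} [TopologicalSpace M] [ChartedSpace H M]
  [IsManifold I ∞ M] {n : ℕ∞ω} [FiniteDimensional ℝ E]
  {g : PseudoRiemannianMetric I n E (TangentSpace I : M → Type _)}

/-! ### §1. Symmetry of the `s`-sections -/

/-- **Symmetry of the metric `s`-sections**: `Mid_s(x, y) = Mid_{1-s}(y, x)`
(the Riemannian distance is symmetric). [folklore] -/
theorem setOf_edist_toReal_le_comm (hg : g.IsRiemannian) (x y : M) (s : ℝ) :
    {z : M | (g.edist hg x z).toReal ≤ s * (g.edist hg x y).toReal ∧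
        (g.edist hg z y).toReal ≤ (1 - s) * (g.edist hg x y).toReal} =
      {z : M | (g.edist hg y z).toReal ≤ (1 - s) * (g.edist hg y x).toReal ∧
        (g.edist hg z x).toReal ≤ (1 - (1 - s)) * (g.edist hg y x).toReal} := by
  ext z
  simp only [mem_setOf_eq]
  rw [sub_sub_cancel, g.edist_comm hg y x, g.edist_comm hg y z, g.edist_comm hg z x]
  exact and_comm

/-- **Symmetry of the segment kernel**: `sup_{Mid_s(x,y)} e = sup_{Mid_{1-s}(y,x)} e`. [folklore] -/
theorem iSup_setOf_edist_toReal_le_comm (hg : g.IsRiemannian) (e : M → ℝ≥0∞) (x y : M)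
    (s : ℝ) :
    (⨆ z ∈ {z : M | (g.edist hg x z).toReal ≤ s * (g.edist hg x y).toReal ∧
        (g.edist hg z y).toReal ≤ (1 - s) * (g.edist hg x y).toReal}, e z) =
      ⨆ z ∈ {z : M | (g.edist hg y z).toReal ≤ (1 - s) * (g.edist hg y x).toReal ∧
        (g.edist hg z x).toReal ≤ (1 - (1 - s)) * (g.edist hg y x).toReal}, e z := by
  rw [setOf_edist_toReal_le_comm hg x y s]

/-! ### §2. Identification with the minimal segment inside the injectivity domain -/

variable [CompleteSpace E] [T2Space M] [BoundarylessManifold I M] [g.HasLeviCivita]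
  [CovariantDerivative.ContMDiffCovariantDerivative g.leviCivita 1]

/-- **The `s`-section of `(x, exp_x v)`, `v ∈ ID(x)`, is the single point `exp_x(s v)`**
(`0 ≤ s ≤ 1`; connected complete smooth Riemannian manifold). `⊇`: `d(x, γ_v(s)) ≤ s|v|` and
`d(γ_v(s), γ_v(1)) ≤ (1-s)|v|` (lengths of sub-segments). `⊆`: if `d(x,z) ≤ s|v|` and
`d(z,y) ≤ (1-s)|v|` then both are equalities and `d(x,y) = d(x,z) + d(z,y)`; a minimizing
segment `γ_a|[0,1]` from `x` to `z` (Hopf–Rinow) prolongs minimally through `y = γ_a(s')`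
(Lee 2018, Prop. 10.32 (a), `exists_isMinimizingUpTo_of_edist_eq_add`), so `s'a` is a minimizing
initial vector for `y`, equal to `v` by uniqueness inside `ID(x)` (`false_of_two_minimizers`);
comparing lengths, `1/s' = s` and `z = γ_v(s)`.
[cite: LeeRiemannianManifolds2018, Prop. 10.32 (a)] -/
theorem setOf_edist_toReal_le_eq_singleton [ConnectedSpace M] (hn : (∞ : ℕ∞ω) ≤ n)
    (hg : g.IsRiemannian) (hc : IsGeodesicallyComplete g.leviCivita) {p : M}
    {v : TangentSpace I p} (hv : v ∈ injectivityDomain g hg p) {s : ℝ} (hs0 : 0 ≤ s)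
    (hs1 : s ≤ 1) :
    {z : M | (g.edist hg p z).toReal ≤ s * (g.edist hg p (riemannianExpMap g p v)).toReal ∧
        (g.edist hg z (riemannianExpMap g p v)).toReal ≤
          (1 - s) * (g.edist hg p (riemannianExpMap g p v)).toReal} =
      {riemannianExpMap g p (s • v)} := by
  haveI : Fact (1 ≤ n) := ⟨le_trans (by exact_mod_cast le_top) hn⟩
  obtain ⟨s₀, hs₀, hmin₀⟩ := hv
  have hmin1 : IsMinimizingUpTo g hg p v 1 := hmin₀.mono hc zero_le_one hs₀.le
  obtain ⟨-, -, h0, -⟩ := maximalGeodesic_of_isGeodesicallyComplete hc p v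
  set γ : ℝ → M := maximalGeodesic g.leviCivita p v with hγ_def
  set ℓ : ℝ := Real.sqrt (g.val p v v) with hℓ_def
  have hℓ0 : 0 ≤ ℓ := Real.sqrt_nonneg _
  set y : M := riemannianExpMap g p v with hy_def
  have hy1 : y = γ 1 := expMap_eq_maximalGeodesic hc p v
  have hdy : g.edist hg p y = ENNReal.ofReal ℓ := edist_eq_of_isMinimizingUpTo hg hc hmin1
  have hdyR : (g.edist hg p y).toReal = ℓ := by rw [hdy, ENNReal.toReal_ofReal hℓ0]
  have hzs : riemannianExpMap g p (s • v) = γ s := expMap_smul hc p v s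
  have hfin : ∀ a b : M, g.edist hg a b ≠ ⊤ := fun a b ↦ edist_ne_top hg a b
  ext z
  simp only [mem_setOf_eq, mem_singleton_iff, hdyR]
  constructor
  · -- `⊆`
    rintro ⟨hz1, hz2⟩
    set a : ℝ := (g.edist hg p z).toReal with ha_def
    set b : ℝ := (g.edist hg z y).toReal with hb_def
    have htri : ℓ ≤ a + b := by
      rw [← hdyR, ha_def, hb_def, ← ENNReal.toReal_add (hfin p z) (hfin z y)]
      exact ENNReal.toReal_mono (ENNReal.add_ne_top.2 ⟨hfin p z, hfin z y⟩)
        (edist_triangle hg p z y)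
    have ha : a = s * ℓ := le_antisymm hz1 (by nlinarith)
    have hb : b = (1 - s) * ℓ := le_antisymm hz2 (by nlinarith)
    have hdz : g.edist hg p z = ENNReal.ofReal a := (ENNReal.ofReal_toReal (hfin p z)).symm
    have hdzy : g.edist hg z y = ENNReal.ofReal b := (ENNReal.ofReal_toReal (hfin z y)).symm
    by_cases hzp : z = p
    · -- degenerate case: `z = p`, so `s ℓ = 0`
      have ha0 : a = 0 := by rw [ha_def, hzp, g.edist_self hg, ENNReal.toReal_zero]
      have hsl : s * ℓ = 0 := by rw [← ha, ha0]
      rcases mul_eq_zero.1 hsl with hs | hl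
      · rw [hzp, hs, zero_smul, riemannianExpMap_zero]
      · have hv0 : v = 0 := by
          by_contra hv0
          have hpos : 0 < g.val p v v := hg p v hv0
          have : ℓ ≠ 0 := by rw [hℓ_def]; exact (Real.sqrt_pos.2 hpos).ne'
          exact this hl
        rw [hzp, hv0, smul_zero, riemannianExpMap_zero]
    · -- generic case: a minimizing segment to `z`, prolonged through `y`
      obtain ⟨a', ha'min, ha'z⟩ :=
        exists_isMinimizingUpTo_of_isGeodesicallyComplete (g := g) hn hg hc p z
      have ha'0 : a' ≠ 0 := by
        rintro rfl
        exact hzp (by rw [← ha'z, riemannianExpMap_zero])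
      have hsum : g.edist hg p y =
          g.edist hg p (riemannianExpMap g p a') + g.edist hg (riemannianExpMap g p a') y := by
        rw [ha'z, hdz, hdzy, hdy, ← ENNReal.ofReal_add (by rw [ha]; positivity)
          (by rw [hb]; nlinarith), ha, hb]
        congr 1
        ring
      obtain ⟨s', hs'1, hmins', hys'⟩ :=
        exists_isMinimizingUpTo_of_edist_eq_add hn hg hc ha'0 ha'min hsum
      have hs'0 : 0 < s' := one_pos.trans_le hs'1
      -- the rescaled vector `w = s' a'` is a minimizing initial vector for `y`
      set w : TangentSpace I p := s' • a' with hw_def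
      have hw_min : IsMinimizingUpTo g hg p w 1 :=
        (isMinimizingUpTo_smul_iff hg hc p a' hs'0 1).2 (by rwa [mul_one])
      have hw_exp : riemannianExpMap g p w = y := by
        show expMap g.leviCivita p (s' • a') = y
        rw [expMap_smul hc, hys']
      -- uniqueness inside the injectivity domain
      have hwv : w = v := by
        by_contra hne
        exact false_of_two_minimizers (g := g) hn hg hc p (Ne.symm hne) hw_exp.symm hw_min hs₀ hmin₀
      -- lengths: `|a'| = a = s ℓ` and `ℓ = |v| = s' |a'|`
      set ℓa : ℝ := Real.sqrt (g.val p a' a') with hℓa_def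
      have hℓa_pos : 0 < ℓa := Real.sqrt_pos.2 (hg p a' ha'0)
      have hda : g.edist hg p z = ENNReal.ofReal ℓa := by
        rw [← ha'z]
        exact edist_eq_of_isMinimizingUpTo hg hc ha'min
      have haℓa : a = ℓa := by
        rw [ha_def, hda, ENNReal.toReal_ofReal hℓa_pos.le]
      have hℓ_eq : ℓ = s' * ℓa := by
        have h1 : g.val p v v = (s' * s') * g.val p a' a' := by
          rw [← hwv, hw_def]
          simp only [map_smul, FunLike.coe_smul, Pi.smul_apply, smul_eq_mul]
          ring
        rw [hℓ_def, h1, Real.sqrt_mul (mul_self_nonneg s'), Real.sqrt_mul_self hs'0.le]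
      have hss' : s * s' = 1 := by
        have h2 : ℓa = s * s' * ℓa := by
          calc ℓa = a := haℓa.symm
            _ = s * ℓ := ha
            _ = s * s' * ℓa := by rw [hℓ_eq]; ring
        by_contra hne
        have : (s * s' - 1) * ℓa = 0 := by linarith
        rcases mul_eq_zero.1 this with h | h
        · exact hne (by linarith)
        · exact hℓa_pos.ne' h
      have hsinv : s = s'⁻¹ := by
        field_simp
        linarith
      -- `z = exp_p a' = exp_p (s v)`
      have ha'v : a' = s • v := by
        rw [hsinv, ← hwv, hw_def, inv_smul_smul₀ hs'0.ne']
      rw [← ha'z, ha'v]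
  · -- `⊇`
    rintro rfl
    rw [hzs, hy1]
    have h0' : maximalGeodesic g.leviCivita p v 0 = p := h0
    have h1 := edist_maximalGeodesic_le_length hg hc p v hs0
    rw [h0', length_maximalGeodesic hg hc p v 0 s, sub_zero] at h1
    have h2 := edist_maximalGeodesic_le_length hg hc p v hs1
    rw [length_maximalGeodesic hg hc p v s 1] at h2
    exact ⟨ENNReal.toReal_le_of_le_ofReal (by positivity) h1,
      ENNReal.toReal_le_of_le_ofReal (by nlinarith) h2⟩

/-- **The segment kernel along a minimal segment**: for `v ∈ ID(x)` and `0 ≤ s ≤ 1`,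
`sup_{z ∈ Mid_s(x, exp_x v)} e(z) = e(exp_x(s v))`. [cite: LeeRiemannianManifolds2018, Prop. 10.32 (a)] -/
theorem iSup_setOf_edist_toReal_le_eq [ConnectedSpace M] (hn : (∞ : ℕ∞ω) ≤ n)
    (hg : g.IsRiemannian) (hc : IsGeodesicallyComplete g.leviCivita) (e : M → ℝ≥0∞) {p : M}
    {v : TangentSpace I p} (hv : v ∈ injectivityDomain g hg p) {s : ℝ} (hs0 : 0 ≤ s)
    (hs1 : s ≤ 1) :
    (⨆ z ∈ {z : M | (g.edist hg p z).toReal ≤ s * (g.edist hg p (riemannianExpMap g p v)).toReal ∧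
        (g.edist hg z (riemannianExpMap g p v)).toReal ≤
          (1 - s) * (g.edist hg p (riemannianExpMap g p v)).toReal}, e z) =
      e (riemannianExpMap g p (s • v)) := by
  rw [setOf_edist_toReal_le_eq_singleton hn hg hc hv hs0 hs1]
  simp only [mem_singleton_iff, iSup_iSup_eq_left]

/-! ### §3. Measurability of the segment kernel -/

omit [CompleteSpace E] [BoundarylessManifold I M] [g.HasLeviCivita]
  [CovariantDerivative.ContMDiffCovariantDerivative g.leviCivita 1] in
/-- **The segment kernel is measurable** (indeed upper semicontinuous) in `(x, y, s)` on a compact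
connected manifold, for continuous `e : M → [0, ∞]`: the graph
`{((x,y,s), z) : z ∈ Mid_s(x,y)}` is closed and `M` is compact, so `{q : Mid(q) ⊆ U}` is open for
open `U` (closed projection along a compact factor), and on a compact section a continuous `e`
attains its supremum (Berge). [folklore] -/
theorem measurable_iSup_setOf_edist_toReal_le [CompactSpace M] [ConnectedSpace M]
    [SecondCountableTopology M] [MeasurableSpace M] [OpensMeasurableSpace M]
    (hg : g.IsRiemannian) {e : M → ℝ≥0∞} (he : Continuous e) :
    Measurable fun q : M × M × ℝ ↦
      ⨆ z ∈ {z : M | (g.edist hg q.1 z).toReal ≤ q.2.2 * (g.edist hg q.1 q.2.1).toReal ∧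
        (g.edist hg z q.2.1).toReal ≤ (1 - q.2.2) * (g.edist hg q.1 q.2.1).toReal}, e z := by
  -- continuity of the real distance in two variables
  have hdc : ∀ {f h : (M × M × ℝ) × M → M}, Continuous f → Continuous h →
      Continuous fun x ↦ (g.edist hg (f x) (h x)).toReal := by
    intro f h hf hh
    have h1 : Continuous fun x ↦ g.edist hg (f x) (h x) :=
      (PseudoRiemannianMetric.continuous_edist hg).comp (hf.prodMk hh)
    exact ENNReal.continuousOn_toReal.comp_continuous h1 fun x ↦ edist_ne_top hg _ _
  -- the closed graph of `Mid`
  set Γ : Set ((M × M × ℝ) × M) := {w | (g.edist hg w.1.1 w.2).toReal ≤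
      w.1.2.2 * (g.edist hg w.1.1 w.1.2.1).toReal ∧
    (g.edist hg w.2 w.1.2.1).toReal ≤ (1 - w.1.2.2) * (g.edist hg w.1.1 w.1.2.1).toReal} with hΓ_def
  have hΓ : IsClosed Γ := by
    have c11 : Continuous fun w : (M × M × ℝ) × M ↦ w.1.1 := continuous_fst.comp continuous_fst
    have c2 : Continuous fun w : (M × M × ℝ) × M ↦ w.2 := continuous_snd
    have c121 : Continuous fun w : (M × M × ℝ) × M ↦ w.1.2.1 :=
      continuous_fst.comp (continuous_snd.comp continuous_fst)
    have c122 : Continuous fun w : (M × M × ℝ) × M ↦ w.1.2.2 :=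
      continuous_snd.comp (continuous_snd.comp continuous_fst)
    have c1s : Continuous fun w : (M × M × ℝ) × M ↦ (1 : ℝ) - w.1.2.2 :=
      continuous_const.sub c122
    exact (isClosed_le (hdc c11 c2) (c122.mul (hdc c11 c121))).inter
      (isClosed_le (hdc c2 c121) (c1s.mul (hdc c11 c121)))
  set φ : M × M × ℝ → ℝ≥0∞ := fun q ↦
    ⨆ z ∈ {z : M | (g.edist hg q.1 z).toReal ≤ q.2.2 * (g.edist hg q.1 q.2.1).toReal ∧
      (g.edist hg z q.2.1).toReal ≤ (1 - q.2.2) * (g.edist hg q.1 q.2.1).toReal}, e z with hφ_def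
  have hmemΓ : ∀ (q : M × M × ℝ) (z : M), (q, z) ∈ Γ ↔
      z ∈ {z : M | (g.edist hg q.1 z).toReal ≤ q.2.2 * (g.edist hg q.1 q.2.1).toReal ∧
        (g.edist hg z q.2.1).toReal ≤ (1 - q.2.2) * (g.edist hg q.1 q.2.1).toReal} :=
    fun q z ↦ Iff.rfl
  have husc : UpperSemicontinuous φ := by
    intro q c hqc
    -- the open set `U = {e < c}` contains the section over `q`
    set U : Set M := e ⁻¹' Iio c with hU_def
    have hUo : IsOpen U := isOpen_Iio.preimage he
    -- the set of bad parameters is closed (projection along the compact factor `M`)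
    set Bad : Set (M × M × ℝ) := Prod.fst '' (Γ ∩ Prod.snd ⁻¹' Uᶜ) with hBad_def
    have hBad : IsClosed Bad :=
      isClosedMap_fst_of_compactSpace _ (hΓ.inter (hUo.isClosed_compl.preimage continuous_snd))
    have hqBad : q ∉ Bad := by
      rintro ⟨⟨q', z⟩, ⟨hzΓ, hzU⟩, rfl⟩
      refine hzU ?_
      show e z < c
      exact lt_of_le_of_lt (le_iSup₂ (f := fun z (_ : z ∈ {z : M |
        (g.edist hg q'.1 z).toReal ≤ q'.2.2 * (g.edist hg q'.1 q'.2.1).toReal ∧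
        (g.edist hg z q'.2.1).toReal ≤ (1 - q'.2.2) * (g.edist hg q'.1 q'.2.1).toReal}) ↦ e z)
        z hzΓ) hqc
    filter_upwards [hBad.isOpen_compl.mem_nhds hqBad] with q' hq'
    -- over `q'` the section lies inside `U`
    have hsub : ∀ z, (q', z) ∈ Γ → e z < c := by
      intro z hz
      by_contra hzc
      exact hq' ⟨(q', z), ⟨hz, hzc⟩, rfl⟩
    have hK : IsCompact {z : M | (q', z) ∈ Γ} :=
      (hΓ.preimage (continuous_const.prodMk continuous_id)).isCompact
    by_cases hne : {z : M | (q', z) ∈ Γ}.Nonempty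
    · obtain ⟨z₀, hz₀, hmax⟩ := hK.exists_isMaxOn hne he.continuousOn
      calc φ q' ≤ e z₀ := iSup₂_le fun z hz ↦ hmax ((hmemΓ q' z).2 hz)
        _ < c := hsub z₀ hz₀
    · calc φ q' ≤ 0 := iSup₂_le fun z hz ↦ (hne ⟨z, (hmemΓ q' z).2 hz⟩).elim
        _ < c := pos_of_gt hqc
  exact husc.measurable

end General

end Literature.Geometry.Riemannian

end
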